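import Literature.Computability.Complexity.StackStrings
import HarnessLib

/-!
# Item lists on stack registers: self-delimiting items, `pushItem`, `popItem`, `moveItems`

Trunk `CplxCore`, toolkit continuing `StackPrograms.lean` (`Com`, `Runs`, `Com.map`/`graft`),
`StackArith.lean` (`clear`, `pour`, `flag`) and `StackStrings.lean` (`loopIter`,
`runs_loop_of_fun`); a sibling of `StackLists.lean` (lists of numerals as nested `boolPair`s, read
by `unpairW`) with a different trade-off: here a register is used as a **list of items** with a
two-bits-per-bit code whose first item is removed by one finite-state pass *keeping the rest in
place*, items carry a sign bit, and payloads may themselves be item lists (rows of a matrix); an item is a bit string `v`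
together with one extra bit `s` (a sign, for the signed integers of `StackInts.lean`), coded
self-delimitingly as

  `encItem v s = (v.reverse.flatMap fun b => [true, b]) ++ [false, s]`

(payload bits tagged `1`, terminator `0 s`; the payload is stored reversed so that popping an
item bit by bit onto another register restores `v` in order), and a list as the concatenation
`encItems` of the codes of its items, first item on top. Two routines, each on its own small
register type (callers embed them with `Com.map` along an injective register assignment and
transport the specifications with `Exec.map`/`graft` of `StackPrograms.lean`):

* `Com.pushItem` on `PUReg = {A, S, L}`: push the item `(A, s)` (`S = flag s`) onto the list
  `L`, emptying `A` and `S` (`runs_pushItem`, `4|A| + 5` steps);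
* `Com.popItem` on `PIReg = {L, A, S, T, Q}`: remove the first item `(v, s)` of the list `L`
  into `A := v`, `S := flag s`, keeping the rest of `L` in place (a finite-state loop drains
  `L` — decoding the first item, copying the remaining bits raw onto the scratch register `T` —
  then pours `T` back; `runs_popItem`, `13|L| + 6` steps; on the empty list nothing happens,
  `runs_popItem_nil`).

Random access, traversals and zips of lists are counter-driven loops of these two routines
(see the LLL machine files). Specifications are stated for well-formed list registers only
(programs only ever build well-formed lists; raw inputs are parsed with `Com.unpair`).

## References

* S. Arora, B. Barak, *Computational Complexity: A Modern Approach*, CUP 2009, §0.1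
  (self-delimiting representations of tuples of strings), §1.3.
* T. Nipkow, G. Klein, *Concrete Semantics with Isabelle/HOL*, Springer 2014, §7.2
  (big-step reasoning about loops).
-/

namespace Literature.Computability.Complexity

open _root_.Computability

/-! ### Item and list codes -/

/-- The code of an item `(v, s)`: payload bits reversed and tagged `true`, then `false, s`.
[cite: AroraBarak2009, §0.1 (self-delimiting tuples)] -/
def encItem (v : List Bool) (s : Bool) : List Bool :=
  (v.reverse.flatMap fun b => [true, b]) ++ [false, s]

/-- The code of a list of items: concatenation, first item on top. [cite: AroraBarak2009, §0.1 (self-delimiting tuples)] -/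
def encItems : List (List Bool × Bool) → List Bool
  | [] => []
  | p :: l => encItem p.1 p.2 ++ encItems l

/-- `encItems` of a cons. [folklore] -/
@[simp] theorem encItems_cons (v : List Bool) (s : Bool) (l : List (List Bool × Bool)) :
    encItems ((v, s) :: l) = encItem v s ++ encItems l := rfl

/-- `encItems` of nil. [folklore] -/
@[simp] theorem encItems_nil : encItems [] = [] := rfl

/-- Length of an item code: `2|v| + 2`. [folklore] -/
@[simp] theorem length_encItem (v : List Bool) (s : Bool) : (encItem v s).length = 2 * v.length + 2 := by
  simp only [encItem, List.length_append, List.length_flatMap, List.length_cons, List.length_nil]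
  induction v with
  | nil => simp
  | cons b v ih => simp [List.sum_cons] at ih ⊢; omega

/-- Length of a list code. [folklore] -/
theorem length_encItems (l : List (List Bool × Bool)) :
    (encItems l).length = (l.map fun p => 2 * p.1.length + 2).sum := by
  induction l with
  | nil => rfl
  | cons p l ih => obtain ⟨v, s⟩ := p; simp [ih]

/-- `encItems` of an append. [folklore] -/
theorem encItems_append (l l' : List (List Bool × Bool)) : encItems (l ++ l') = encItems l ++ encItems l' := by
  induction l with
  | nil => rfl
  | cons p l ih => obtain ⟨v, s⟩ := p; simp [ih]

namespace Com

/-! ### `pushItem` -/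

/-- Registers of `pushItem`: payload `A`, sign flag `S`, list `L`. [folklore] -/
inductive PUReg where
  | A | S | L
  deriving DecidableEq, Fintype, Repr

namespace PUReg

/-- A register file of `pushItem` given register by register. [folklore] -/
def file (a s l : List Bool) : Regs PUReg
  | .A => a | .S => s | .L => l

section
variable (a s l v : List Bool)
/-- Reading `A`. [folklore] -/ @[simp] theorem file_A : file a s l .A = a := rfl
/-- Reading `S`. [folklore] -/ @[simp] theorem file_S : file a s l .S = s := rfl
/-- Reading `L`. [folklore] -/ @[simp] theorem file_L : file a s l .L = l := rfl
/-- Writing `A`. [folklore] -/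
@[simp] theorem update_file_A : Function.update (file a s l) .A v = file v s l := by
  funext r; cases r <;> rfl
/-- Writing `S`. [folklore] -/
@[simp] theorem update_file_S : Function.update (file a s l) .S v = file a v l := by
  funext r; cases r <;> rfl
/-- Writing `L`. [folklore] -/
@[simp] theorem update_file_L : Function.update (file a s l) .L v = file a s v := by
  funext r; cases r <;> rfl
end

/-- Every register file is a `file`. [folklore] -/
theorem eq_file (R : Regs PUReg) : R = file (R .A) (R .S) (R .L) := by
  funext r; cases r <;> rfl

end PUReg

open PUReg in
/-- `pushItem`: push the item `(A, s)` (sign read off the flag register `S`) onto the list `L`: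
first the terminator `s` then `false`, then every payload bit tagged `true`; empties `A`, `S`.
[cite: AroraBarak2009, §0.1 (self-delimiting tuples)] -/
def pushItem : Com PUReg :=
  pop .S (push .L true) (push .L false) (push .L false) ;; push .L false ;;
  loop .A (push .L true ;; push .L true) (push .L false ;; push .L true)

open PUReg in
/-- The tagging loop of `pushItem`. [folklore] -/
theorem runs_pushItem_loop (v : List Bool) : ∀ (l : List Bool),
    Runs (loop PUReg.A (push .L true ;; push .L true) (push .L false ;; push .L true))
      (file v [] l) (file [] [] ((v.reverse.flatMap fun b => [true, b]) ++ l)) (4 * v.length + 1) := by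
  induction v with
  | nil => intro l; exact (Runs.loop_nil _ _ (R := file [] [] l) rfl).mono (by simp)
  | cons b v ih =>
    intro l
    have hbody : ∀ c : Bool, Runs (push PUReg.L c ;; push .L true) (file v [] l) (file v [] (true :: c :: l)) 2 :=
      fun c => (Runs.push' (R := file v [] l) (R' := file v [] (c :: l)) (by simp)).seq
        (Runs.push' (R' := file v [] (true :: c :: l)) (by simp))
    have e : ((b :: v).reverse.flatMap fun b => [true, b]) ++ l =
        (v.reverse.flatMap fun b => [true, b]) ++ (true :: b :: l) := by simp
    rw [e]
    cases b
    · exact (Runs.loop_false' (R := file (false :: v) [] l) (R₀ := file v [] l) (w := v) rfl (by simp)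
        (hbody false) (ih _)).of_eq rfl (by simp; omega)
    · exact (Runs.loop_true' (R := file (true :: v) [] l) (R₀ := file v [] l) (w := v) rfl (by simp)
        (hbody true) (ih _)).of_eq rfl (by simp; omega)

open PUReg in
/-- **Simulation of `pushItem`**: from `A = v`, `S = flag s`, `L = l` it reaches `A = S = []`,
`L = encItem v s ++ l` within `4|v| + 5` steps. [cite: AroraBarak2009, §0.1 (self-delimiting tuples)] -/
theorem runs_pushItem (v : List Bool) (s : Bool) (l : List Bool) :
    Runs pushItem (file v (flag s) l) (file [] [] (encItem v s ++ l)) (4 * v.length + 5) := by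
  have h1 : Runs (pop PUReg.S (push .L true) (push .L false) (push .L false)) (file v (flag s) l)
      (file v [] (s :: l)) 3 := by
    cases s
    · exact Runs.pop_nil _ _ (R := file v (flag false) l) rfl
        (Runs.push' (R' := file v [] (false :: l)) (by simp))
    · exact Runs.pop_true' _ _ (R := file v (flag true) l) (w := []) rfl (by simp)
        (Runs.push' (R := file v [] l) (R' := file v [] (true :: l)) (by simp))
  have h2 : Runs (push PUReg.L false) (file v [] (s :: l)) (file v [] (false :: s :: l)) 1 :=
    Runs.push' (R' := file v [] (false :: s :: l)) (by simp)
  have h3 := runs_pushItem_loop v (false :: s :: l)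
  refine (h1.seq (h2.seq h3)).of_eq ?_ (by omega)
  simp [encItem]

/-! ### `popItem` -/

/-- Registers of `popItem`: list `L`, payload `A`, sign flag `S`, scratch `T`, state `Q`.
[folklore] -/
inductive PIReg where
  | L | A | S | T | Q
  deriving DecidableEq, Fintype, Repr

namespace PIReg

/-- A register file of `popItem` given register by register. [folklore] -/
def file (l a s t q : List Bool) : Regs PIReg
  | .L => l | .A => a | .S => s | .T => t | .Q => q

section
variable (l a s t q v : List Bool)
/-- Reading `L`. [folklore] -/ @[simp] theorem file_L : file l a s t q .L = l := rfl
/-- Reading `A`. [folklore] -/ @[simp] theorem file_A : file l a s t q .A = a := rfl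
/-- Reading `S`. [folklore] -/ @[simp] theorem file_S : file l a s t q .S = s := rfl
/-- Reading `T`. [folklore] -/ @[simp] theorem file_T : file l a s t q .T = t := rfl
/-- Reading `Q`. [folklore] -/ @[simp] theorem file_Q : file l a s t q .Q = q := rfl
/-- Writing `L`. [folklore] -/
@[simp] theorem update_file_L : Function.update (file l a s t q) .L v = file v a s t q := by
  funext r; cases r <;> rfl
/-- Writing `A`. [folklore] -/
@[simp] theorem update_file_A : Function.update (file l a s t q) .A v = file l v s t q := by
  funext r; cases r <;> rfl
/-- Writing `S`. [folklore] -/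
@[simp] theorem update_file_S : Function.update (file l a s t q) .S v = file l a v t q := by
  funext r; cases r <;> rfl
/-- Writing `T`. [folklore] -/
@[simp] theorem update_file_T : Function.update (file l a s t q) .T v = file l a s v q := by
  funext r; cases r <;> rfl
/-- Writing `Q`. [folklore] -/
@[simp] theorem update_file_Q : Function.update (file l a s t q) .Q v = file l a s t v := by
  funext r; cases r <;> rfl
end

/-- Every register file is a `file`. [folklore] -/
theorem eq_file (R : Regs PIReg) : R = file (R .L) (R .A) (R .S) (R .T) (R .Q) := by
  funext r; cases r <;> rfl

end PIReg

open PIReg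

/-- The loop body of `popItem` on the popped bit `b`. The state register `Q` holds `[]`
(expecting a tag), `[true]` (expecting a payload bit), `[false]` (expecting the sign bit) or
`[false, true]` (first item done: copying the rest raw onto `T`). [folklore] -/
def popItemBody (b : Bool) : Com PIReg :=
  pop .Q
    (push .A b)                                             -- payload bit
    (pop .Q
      (push .Q true ;; push .Q false ;; push .T b)          -- rest: raw copy (restore `Q`)
      (push .Q true ;; push .Q false ;; push .T b)          -- (unreachable)
      ((bif b then push .S true else skip) ;; push .Q true ;; push .Q false))  -- sign bit
    (bif b then push .Q true else push .Q false)            -- tag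

/-- `popItem`: remove the first item of `L` into `A` (payload) and `S` (sign flag), keeping
the rest of `L`. [cite: AroraBarak2009, §0.1 (self-delimiting tuples)] -/
def popItem : Com PIReg :=
  loop .L (popItemBody true) (popItemBody false) ;; pour .T .L ;; clear .Q

/-- One iteration of `popItem` (functional form). [folklore] -/
def popItemStep (b : Bool) (R : Regs PIReg) : Regs PIReg :=
  match R .Q with
  | true :: q => Function.update (Function.update R .Q q) .A (b :: R .A)
  | false :: _ :: q => Function.update (Function.update R .Q (false :: true :: q)) .T (b :: R .T)
  | [false] => Function.update (Function.update R .Q [false, true]) .S (bif b then true :: R .S else R .S)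
  | [] => Function.update R .Q [b]

/-- The loop body realises `popItemStep` within 7 steps (on a `file`). [folklore] -/
theorem runs_popItemBody_file (b : Bool) (w a s t q : List Bool) :
    Runs (popItemBody b) (file w a s t q) (popItemStep b (file w a s t q)) 7 := by
  rcases q with _ | ⟨c, q⟩
  · -- tag expected
    have e : popItemStep b (file w a s t []) = file w a s t [b] := by simp [popItemStep]
    rw [e]
    have hp : Runs (bif b then push PIReg.Q true else push .Q false) (file w a s t []) (file w a s t [b]) 1 := by
      cases b
      · exact Runs.push' (R' := file w a s t [false]) (by simp)
      · exact Runs.push' (R' := file w a s t [true]) (by simp)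
    exact (Runs.pop_nil _ _ (R := file w a s t []) rfl hp).mono (by omega)
  · cases c
    · rcases q with _ | ⟨c', q'⟩
      · -- sign bit
        have e : popItemStep b (file w a s t [false]) =
            file w a (bif b then true :: s else s) t [false, true] := by simp [popItemStep]
        rw [e]
        have hsg : Runs ((bif b then push PIReg.S true else skip) ;; push .Q true ;; push .Q false)
            (file w a s t []) (file w a (bif b then true :: s else s) t [false, true]) 3 := by
          cases b
          · exact ((Runs.skip _).seq ((Runs.push' (R := file w a s t []) (R' := file w a s t [true])
              (by simp)).seq (Runs.push' (R' := file w a s t [false, true]) (by simp)))).mono (by omega)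
          · exact (Runs.push' (R := file w a s t []) (R' := file w a (true :: s) t []) (by simp)).seq
              ((Runs.push' (R' := file w a (true :: s) t [true]) (by simp)).seq
                (Runs.push' (R' := file w a (true :: s) t [false, true]) (by simp)))
        have h2 : Runs (pop PIReg.Q (push .Q true ;; push .Q false ;; push .T b)
            (push .Q true ;; push .Q false ;; push .T b)
            ((bif b then push .S true else skip) ;; push .Q true ;; push .Q false))
            (file w a s t []) (file w a (bif b then true :: s else s) t [false, true]) 5 :=
          Runs.pop_nil _ _ (R := file w a s t []) rfl hsg
        exact (Runs.pop_false' _ _ (R := file w a s t [false]) (R₀ := file w a s t []) (w := [])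
          rfl (by simp) h2).mono (by omega)
      · -- rest phase (`c' = true`; `c' = false` is unreachable and behaves alike)
        have e : popItemStep b (file w a s t (false :: c' :: q')) =
            file w a s (b :: t) (false :: true :: q') := by simp [popItemStep]
        rw [e]
        have hrest : Runs (push PIReg.Q true ;; push .Q false ;; push .T b) (file w a s t q')
            (file w a s (b :: t) (false :: true :: q')) 3 :=
          (Runs.push' (R := file w a s t q') (R' := file w a s t (true :: q')) (by simp)).seq
            ((Runs.push' (R' := file w a s t (false :: true :: q')) (by simp)).seq
              (Runs.push' (R' := file w a s (b :: t) (false :: true :: q')) (by simp)))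
        have h2 : Runs (pop PIReg.Q (push .Q true ;; push .Q false ;; push .T b)
            (push .Q true ;; push .Q false ;; push .T b)
            ((bif b then push .S true else skip) ;; push .Q true ;; push .Q false))
            (file w a s t (c' :: q')) (file w a s (b :: t) (false :: true :: q')) 5 := by
          cases c'
          · exact Runs.pop_false' _ _ (R := file w a s t (false :: q')) (R₀ := file w a s t q')
              (w := q') rfl (by simp) hrest
          · exact Runs.pop_true' _ _ (R := file w a s t (true :: q')) (R₀ := file w a s t q')
              (w := q') rfl (by simp) hrest
        exact (Runs.pop_false' _ _ (R := file w a s t (false :: c' :: q')) (R₀ := file w a s t (c' :: q'))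
          (w := c' :: q') rfl (by simp) h2).mono (by omega)
    · -- payload bit
      have e : popItemStep b (file w a s t (true :: q)) = file w (b :: a) s t q := by simp [popItemStep]
      rw [e]
      exact (Runs.pop_true' _ _ (R := file w a s t (true :: q)) (R₀ := file w a s t q) (w := q) rfl
        (by simp) (Runs.push' (R' := file w (b :: a) s t q) (by simp))).mono (by omega)

/-- `popItemStep` does not touch `L`. [folklore] -/
theorem popItemStep_L (b : Bool) (R : Regs PIReg) : popItemStep b R .L = R .L := by
  rw [eq_file R]
  rcases R .Q with _ | ⟨c, q⟩
  · simp [popItemStep]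
  · cases c
    · rcases q with _ | ⟨c', q'⟩ <;> simp [popItemStep]
    · simp [popItemStep]

/-- The loop body of `popItem` realises `popItemStep` (in the form used by `runs_loop_of_fun`).
[folklore] -/
theorem runs_popItemBody (b : Bool) (w : List Bool) (R : Regs PIReg) (_hk : R .L = b :: w) :
    Runs (bif b then popItemBody true else popItemBody false) (Function.update R .L w)
      (popItemStep b (Function.update R .L w)) 7 ∧
    popItemStep b (Function.update R .L w) .L = w := by
  have e : Function.update R .L w = file w (R .A) (R .S) (R .T) (R .Q) := by
    rw [eq_file R]; simp
  have hb : (bif b then popItemBody true else popItemBody false) = popItemBody b := by cases b <;> rfl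
  rw [hb, e]
  exact ⟨runs_popItemBody_file b w _ _ _ _, by rw [popItemStep_L]; rfl⟩

/-- The raw-copy phase: every remaining bit goes onto `T`. [folklore] -/
theorem loopIter_popItem_rest (a sg : List Bool) (q : List Bool) :
    ∀ (r t : List Bool),
      loopIter PIReg.L popItemStep r (file r a sg t (false :: true :: q)) =
        file [] a sg (r.reverse ++ t) (false :: true :: q) := by
  intro r
  induction r with
  | nil => intro t; simp
  | cons c r ih =>
    intro t
    rw [loopIter_cons, update_file_L]
    have e : popItemStep c (file r a sg t (false :: true :: q)) = file r a sg (c :: t) (false :: true :: q) := by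
      simp [popItemStep]
    rw [e, ih]
    simp

/-- The decoding phase: on `(u.flatMap [1,·]) ++ [0, s] ++ rest` from the tag state with
payload accumulator `a`, the loop appends `u` (reversed) to `a`, records the sign, and copies
`rest` reversed onto `T`. [folklore] -/
theorem loopIter_popItem_tagged (s : Bool) (rest t : List Bool) :
    ∀ (u a sg : List Bool),
      loopIter PIReg.L popItemStep ((u.flatMap fun b => [true, b]) ++ false :: s :: rest)
        (file ((u.flatMap fun b => [true, b]) ++ false :: s :: rest) a sg t []) =
        file [] (u.reverse ++ a) (bif s then true :: sg else sg) (rest.reverse ++ t) [false, true] := by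
  intro u
  induction u with
  | nil =>
    intro a sg
    rw [List.flatMap_nil, List.nil_append, loopIter_cons, update_file_L]
    have e1 : popItemStep false (file (s :: rest) a sg t []) = file (s :: rest) a sg t [false] := by
      simp [popItemStep]
    rw [e1, loopIter_cons, update_file_L]
    have e2 : popItemStep s (file rest a sg t [false]) =
        file rest a (bif s then true :: sg else sg) t [false, true] := by
      simp [popItemStep]
    rw [e2, loopIter_popItem_rest]
    simp
  | cons x u ih =>
    intro a sg
    have eshape : ((x :: u).flatMap fun b => [true, b]) ++ false :: s :: rest =
        true :: x :: ((u.flatMap fun b => [true, b]) ++ false :: s :: rest) := by simp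
    rw [eshape, loopIter_cons, update_file_L]
    have e1 : popItemStep true (file (x :: (List.flatMap (fun b => [true, b]) u ++ false :: s :: rest)) a sg t []) =
        file (x :: (List.flatMap (fun b => [true, b]) u ++ false :: s :: rest)) a sg t [true] := by
      simp [popItemStep]
    rw [e1, loopIter_cons, update_file_L]
    have e2 : popItemStep x (file (List.flatMap (fun b => [true, b]) u ++ false :: s :: rest) a sg t [true]) =
        file (List.flatMap (fun b => [true, b]) u ++ false :: s :: rest) (x :: a) sg t [] := by
      simp [popItemStep]
    rw [e2, ih (x :: a) sg]
    simp

/-- **Simulation of `popItem`**: from `L = encItem v s ++ rest`, `A = S = T = Q = []` it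
reaches `L = rest`, `A = v`, `S = flag s`, `T = Q = []` within `13|L| + 6` steps.
[cite: AroraBarak2009, §0.1 (self-delimiting tuples)] -/
theorem runs_popItem (v : List Bool) (s : Bool) (rest : List Bool) :
    Runs popItem (file (encItem v s ++ rest) [] [] [] []) (file rest v (flag s) [] [])
      (13 * (encItem v s ++ rest).length + 6) := by
  have hl := runs_loop_of_fun (k := PIReg.L) (ct := popItemBody true) (cf := popItemBody false)
    popItemStep 7 (fun b w R hk => runs_popItemBody b w R hk) (encItem v s ++ rest)
    (file (encItem v s ++ rest) [] [] [] []) rfl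
  have hiter : loopIter PIReg.L popItemStep (encItem v s ++ rest) (file (encItem v s ++ rest) [] [] [] []) =
      file [] v (flag s) rest.reverse [false, true] := by
    have := loopIter_popItem_tagged s rest [] v.reverse [] []
    simp only [encItem, List.append_assoc, List.cons_append, List.nil_append] at this ⊢
    rw [this]
    cases s <;> simp
  rw [hiter] at hl
  have hp : Runs (pour PIReg.T .L) (file [] v (flag s) rest.reverse [false, true])
      (file rest v (flag s) [] [false, true]) (3 * rest.length + 1) :=
    (runs_pour (a := PIReg.T) (b := PIReg.L) (by decide) _).of_eq (by simp) (by simp)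
  have hc : Runs (clear PIReg.Q) (file rest v (flag s) [] [false, true]) (file rest v (flag s) [] []) 5 :=
    (runs_clear PIReg.Q _).of_eq (by simp) (by simp)
  refine (hl.seq (hp.seq hc)).of_eq rfl ?_
  simp only [List.length_append, length_encItem]
  omega

/-- `popItem` on the empty list does nothing (the "item" read is `([], false)` if `A`, `S` were
empty). [folklore] -/
theorem runs_popItem_nil (a sg : List Bool) :
    Runs popItem (file [] a sg [] []) (file [] a sg [] []) 6 := by
  have hl : Runs (loop PIReg.L (popItemBody true) (popItemBody false)) (file [] a sg [] [])
      (file [] a sg [] []) 1 := Runs.loop_nil _ _ rfl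
  have hp : Runs (pour PIReg.T .L) (file [] a sg [] []) (file [] a sg [] []) 1 :=
    (runs_pour (a := PIReg.T) (b := PIReg.L) (by decide) (file [] a sg [] [])).of_eq (by simp) (by simp)
  have hc : Runs (clear PIReg.Q) (file [] a sg [] []) (file [] a sg [] []) 1 :=
    (runs_clear PIReg.Q (file [] a sg [] [])).of_eq (by simp) (by simp)
  exact (hl.seq (hp.seq hc)).mono (by omega)

/-! ### Embedding routines: transport of specifications along register renamings -/

section Map

variable {ι κ : Type} [DecidableEq ι] [DecidableEq κ]

/-- **A routine embedded along an injective register assignment runs on the ambient file**,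
the registers outside the assignment being untouched (`Exec.map`). [folklore] -/
theorem Runs.map {f : ι → κ} (hf : Function.Injective f) {c : Com ι} {R R' : Regs ι} {B : ℕ}
    (h : Runs c R R' B) (S : Regs κ) (hS : ∀ i, S (f i) = R i) :
    Runs (c.map f) S (graft S f R') B := by
  obtain ⟨t, ht, e⟩ := h
  exact ⟨t, ht, e.map hf S hS⟩

/-- The same for stopping executions. [folklore] -/
theorem Halts.map {f : ι → κ} (hf : Function.Injective f) {c : Com ι} {R R' : Regs ι} {B : ℕ}
    (h : Halts c R R' B) (S : Regs κ) (hS : ∀ i, S (f i) = R i) :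
    Halts (c.map f) S (graft S f R') B := by
  obtain ⟨t, ht, e⟩ := h
  exact ⟨t, ht, e.map hf S hS⟩

end Map

/-! ### Moving items between two lists -/

/-- Registers of the two-list routines: source `L₁`, target `L₂`, item payload `A`, sign `S`,
scratch `T`, state `Q`, counter `C`. [folklore] -/
inductive MVReg where
  | L₁ | L₂ | A | S | T | Q | C
  deriving DecidableEq, Fintype, Repr

namespace MVReg

/-- A register file of the two-list routines given register by register. [folklore] -/
def file (l₁ l₂ a s t q c : List Bool) : Regs MVReg
  | .L₁ => l₁ | .L₂ => l₂ | .A => a | .S => s | .T => t | .Q => q | .C => c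

section
variable (l₁ l₂ a s t q c v : List Bool)
/-- Reading `L₁`. [folklore] -/ @[simp] theorem file_L₁ : file l₁ l₂ a s t q c .L₁ = l₁ := rfl
/-- Reading `L₂`. [folklore] -/ @[simp] theorem file_L₂ : file l₁ l₂ a s t q c .L₂ = l₂ := rfl
/-- Reading `A`. [folklore] -/ @[simp] theorem file_A : file l₁ l₂ a s t q c .A = a := rfl
/-- Reading `S`. [folklore] -/ @[simp] theorem file_S : file l₁ l₂ a s t q c .S = s := rfl
/-- Reading `T`. [folklore] -/ @[simp] theorem file_T : file l₁ l₂ a s t q c .T = t := rfl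
/-- Reading `Q`. [folklore] -/ @[simp] theorem file_Q : file l₁ l₂ a s t q c .Q = q := rfl
/-- Reading `C`. [folklore] -/ @[simp] theorem file_C : file l₁ l₂ a s t q c .C = c := rfl
/-- Writing `L₁`. [folklore] -/
@[simp] theorem update_file_L₁ : Function.update (file l₁ l₂ a s t q c) .L₁ v = file v l₂ a s t q c := by
  funext r; cases r <;> rfl
/-- Writing `L₂`. [folklore] -/
@[simp] theorem update_file_L₂ : Function.update (file l₁ l₂ a s t q c) .L₂ v = file l₁ v a s t q c := by
  funext r; cases r <;> rfl
/-- Writing `A`. [folklore] -/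
@[simp] theorem update_file_A : Function.update (file l₁ l₂ a s t q c) .A v = file l₁ l₂ v s t q c := by
  funext r; cases r <;> rfl
/-- Writing `S`. [folklore] -/
@[simp] theorem update_file_S : Function.update (file l₁ l₂ a s t q c) .S v = file l₁ l₂ a v t q c := by
  funext r; cases r <;> rfl
/-- Writing `T`. [folklore] -/
@[simp] theorem update_file_T : Function.update (file l₁ l₂ a s t q c) .T v = file l₁ l₂ a s v q c := by
  funext r; cases r <;> rfl
/-- Writing `Q`. [folklore] -/
@[simp] theorem update_file_Q : Function.update (file l₁ l₂ a s t q c) .Q v = file l₁ l₂ a s t v c := by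
  funext r; cases r <;> rfl
/-- Writing `C`. [folklore] -/
@[simp] theorem update_file_C : Function.update (file l₁ l₂ a s t q c) .C v = file l₁ l₂ a s t q v := by
  funext r; cases r <;> rfl
end

/-- Every register file is a `file`. [folklore] -/
theorem eq_file (R : Regs MVReg) : R = file (R .L₁) (R .L₂) (R .A) (R .S) (R .T) (R .Q) (R .C) := by
  funext r; cases r <;> rfl

/-- The register assignment of `popItem` (source list `L₁`). [folklore] -/
def ofPI : PIReg → MVReg
  | .L => .L₁ | .A => .A | .S => .S | .T => .T | .Q => .Q

/-- The register assignment of `pushItem` (target list `L₂`). [folklore] -/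
def ofPU : PUReg → MVReg
  | .A => .A | .S => .S | .L => .L₂

/-- `ofPI` is injective. [folklore] -/
theorem ofPI_injective : Function.Injective ofPI := by
  intro a b h; cases a <;> cases b <;> first | rfl | cases h

/-- `ofPU` is injective. [folklore] -/
theorem ofPU_injective : Function.Injective ofPU := by
  intro a b h; cases a <;> cases b <;> first | rfl | cases h

/-- Grafting a `popItem` file. [folklore] -/
@[simp] theorem graft_ofPI (l₁ l₂ a s t q c l' a' s' t' q' : List Bool) :
    graft (file l₁ l₂ a s t q c) ofPI (PIReg.file l' a' s' t' q') = file l' l₂ a' s' t' q' c := by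
  funext r
  cases r
  · exact graft_apply _ ofPI_injective _ PIReg.L
  · exact graft_of_not _ _ _ (fun i => by cases i <;> simp [ofPI])
  · exact graft_apply _ ofPI_injective _ PIReg.A
  · exact graft_apply _ ofPI_injective _ PIReg.S
  · exact graft_apply _ ofPI_injective _ PIReg.T
  · exact graft_apply _ ofPI_injective _ PIReg.Q
  · exact graft_of_not _ _ _ (fun i => by cases i <;> simp [ofPI])

/-- Grafting a `pushItem` file. [folklore] -/
@[simp] theorem graft_ofPU (l₁ l₂ a s t q c a' s' l' : List Bool) :
    graft (file l₁ l₂ a s t q c) ofPU (PUReg.file a' s' l') = file l₁ l' a' s' t q c := by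
  funext r
  cases r
  · exact graft_of_not _ _ _ (fun i => by cases i <;> simp [ofPU])
  · exact graft_apply _ ofPU_injective _ PUReg.L
  · exact graft_apply _ ofPU_injective _ PUReg.A
  · exact graft_apply _ ofPU_injective _ PUReg.S
  · exact graft_of_not _ _ _ (fun i => by cases i <;> simp [ofPU])
  · exact graft_of_not _ _ _ (fun i => by cases i <;> simp [ofPU])
  · exact graft_of_not _ _ _ (fun i => by cases i <;> simp [ofPU])

end MVReg

open MVReg

/-- `moveItem`: move the first item of `L₁` onto `L₂` (via `A`, `S`). [folklore] -/
def moveItem : Com MVReg := popItem.map ofPI ;; pushItem.map ofPU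

/-- **Simulation of `moveItem`**: `L₁ = encItem v s ++ rest ↦ rest`, `L₂ = l₂ ↦ encItem v s ++ l₂`,
within `13|L₁| + 4|v| + 11` steps (from `A = S = T = Q = []`). [folklore] -/
theorem runs_moveItem (v : List Bool) (s : Bool) (rest l₂ c : List Bool) :
    Runs moveItem (file (encItem v s ++ rest) l₂ [] [] [] [] c) (file rest (encItem v s ++ l₂) [] [] [] [] c)
      (13 * (encItem v s ++ rest).length + 6 + (4 * v.length + 5)) := by
  have h1 := Runs.map ofPI_injective (runs_popItem v s rest) (file (encItem v s ++ rest) l₂ [] [] [] [] c)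
    (fun i => by cases i <;> rfl)
  rw [graft_ofPI] at h1
  have h2 := Runs.map ofPU_injective (runs_pushItem v s l₂) (file rest l₂ v (flag s) [] [] c)
    (fun i => by cases i <;> rfl)
  rw [graft_ofPU] at h2
  exact h1.seq h2

/-- `moveItem` on an empty source pushes the empty item `([], false)`. [folklore] -/
theorem runs_moveItem_nil (l₂ c : List Bool) :
    Runs moveItem (file [] l₂ [] [] [] [] c) (file [] (encItem [] false ++ l₂) [] [] [] [] c) 11 := by
  have h1 := Runs.map ofPI_injective (runs_popItem_nil [] []) (file [] l₂ [] [] [] [] c)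
    (fun i => by cases i <;> rfl)
  rw [graft_ofPI] at h1
  have h2 := Runs.map ofPU_injective (runs_pushItem [] false l₂) (file [] l₂ [] (flag false) [] [] c)
    (fun i => by cases i <;> rfl)
  rw [graft_ofPU] at h2
  exact (h1.seq h2).mono (by simp)

/-- `moveItems`: move as many items from `L₁` onto `L₂` as there are bits in the counter `C`
(which is consumed). [folklore] -/
def moveItems : Com MVReg := loop .C moveItem moveItem

/-- **Simulation of `moveItems`**: with a counter of length `n` and at least `n` items `ws` on
`L₁` (above `r`), the first `n` items end reversed on top of `L₂`, each iteration costing at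
most `13 M + 4 N + 17` if every source content is `≤ M` long and every payload `≤ N`; here with
the crude bound `M = |L₁|`, `N = |L₁|`. [folklore] -/
theorem runs_moveItems : ∀ (cnt : List Bool) (ws : List (List Bool × Bool)) (r l₂ : List Bool),
    cnt.length ≤ ws.length →
    Runs moveItems (file (encItems ws ++ r) l₂ [] [] [] [] cnt)
      (file (encItems (ws.drop cnt.length) ++ r) (encItems (ws.take cnt.length).reverse ++ l₂) [] [] [] [] [])
      (cnt.length * (17 * (encItems ws ++ r).length + 13) + 1) := by
  intro cnt
  induction cnt with
  | nil =>
    intro ws r l₂ _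
    exact (Runs.loop_nil _ _ (R := file (encItems ws ++ r) l₂ [] [] [] [] []) rfl).of_eq (by simp) (by simp)
  | cons b cnt ih =>
    intro ws r l₂ hlen
    obtain _ | ⟨⟨v, s⟩, ws⟩ := ws
    · simp at hlen
    · simp only [List.length_cons, Nat.succ_le_succ_iff] at hlen
      set LEN := (encItems ((v, s) :: ws) ++ r).length with hLEN
      have hmv := runs_moveItem v s (encItems ws ++ r) l₂ cnt
      rw [← List.append_assoc] at hmv
      have hf : (encItem v s ++ encItems ws ++ r).length = LEN := by simp [hLEN]
      rw [hf] at hmv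
      have hih := ih ws r (encItem v s ++ l₂) hlen
      set H := cnt.length * (17 * LEN + 13) with hH
      have hm : cnt.length * (17 * (encItems ws ++ r).length + 13) ≤ H :=
        Nat.mul_le_mul_left _ (by simp [hLEN])
      have hg : v.length ≤ LEN := by simp [hLEN]; omega
      have hj : (cnt.length + 1) * (17 * LEN + 13) + 1 = H + (17 * LEN + 13) + 1 := by rw [hH]; ring
      have e : encItems (List.take (cnt.length + 1) ((v, s) :: ws)).reverse ++ l₂ =
          encItems (ws.take cnt.length).reverse ++ (encItem v s ++ l₂) := by
        simp [List.take_succ_cons, encItems_append]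
      simp only [List.length_cons, List.drop_succ_cons]
      rw [e, hj]
      have hfin : 13 * LEN + 6 + (4 * v.length + 5) + 2 +
          (cnt.length * (17 * (encItems ws ++ r).length + 13) + 1) ≤ H + (17 * LEN + 13) + 1 := by omega
      cases b
      · exact (Runs.loop_false' (R := file (encItem v s ++ encItems ws ++ r) l₂ [] [] [] [] (false :: cnt))
          (R₀ := file (encItem v s ++ encItems ws ++ r) l₂ [] [] [] [] cnt) (w := cnt) rfl (by simp) hmv hih).of_eq
          rfl hfin
      · exact (Runs.loop_true' (R := file (encItem v s ++ encItems ws ++ r) l₂ [] [] [] [] (true :: cnt))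
          (R₀ := file (encItem v s ++ encItems ws ++ r) l₂ [] [] [] [] cnt) (w := cnt) rfl (by simp) hmv hih).of_eq
          rfl hfin

end Com

end Literature.Computability.Complexity
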